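import Summits.Ventures.LatticeQCDFlow.Exactness.FlowSamplerSymmetrisation
import Summits.Ventures.LatticeQCDFlow.Exactness.FlowSamplerSquareIntegrableAcceptanceCeiling
import Summits.Ventures.LatticeQCDFlow.Exactness.Phi4FlowSquareIntegrableCeiling
import HarnessLib

/-!
# SYMMETRISING A FLOW NEVER RAISES THE CERTIFIED CEILING: for every observable with `g² ∘ σ = g²` — the EVEN observables of record (`E`, `χ₂`, `G(0,0)`) included — `G₂(q̃ₛ) ≤ G₂(q̃)`, `ā(q̃ₛ) ≥ ā(q̃)`, so `τ_int^{q̃ₛ}(g) ≤ E_{g²}[1/ρ_q̃]/ā_q̃ − ½`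

HONEST FRAMING: exact (Metropolis-corrected) sampling algorithms for lattice gauge theory;
figures of merit are autocorrelation/cost numbers at stated couplings and volumes; no
continuum-physics claim.  (SCALAR calibration rung S0-A: not a gauge result.)

Venture `LatticeQCDFlow` (cell pub-lqcd), topic `Exactness`; FANOUT row 2 (`s0-phi4`, FLOW arm).
NEW WORK of the cell, the EVEN-SECTOR companion of `FlowSamplerSymmetrisation`: row 2's observables
of record for S0-A are even (`E`, `χ₂ = V M̄²`, `G(0,0)`), and for even `g` the symmetrised sampler is
not diagonal — but the acceptance-weighted CEILING of `FlowSamplerSquareIntegrableAcceptanceCeiling`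
(`τ_int(g) ≤ G₂ (Z/P_ρ)/P − ½ = E_{g²}[1/ρ]/ā − ½`, Deligiannidis–Lee shape, NAMED there) can only
improve: pointwise `r_{q̃ₛ} ≤ ½(r_q̃ + r_q̃∘σ)` and convexity of `t ↦ 1/(1 − t)` give
`1/ρ_{q̃ₛ} ≤ ½(1/ρ_q̃ + 1/ρ_q̃∘σ)`, hence `G₂(q̃ₛ) = ∫ g² w/ρ_{q̃ₛ} ≤ G₂(q̃)` for `g² ∘ σ = g²`, while
`P_ρ(q̃ₛ) = ∫ ρ_{q̃ₛ} w ≥ P_ρ(q̃)` (`symmetrised_meanRejection_le`).  Nothing is cited as a fact.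

## What is proved

General (`σ` a measure-preserving involution, `w ∘ σ = w`, `w, q̃ > 0`, `∫ q̃ = 1`, `q̃ₛ = ½(q̃ + q̃∘σ)`):
* `one_div_one_sub_le_midpoint` — `1/(1 − m) ≤ ½(1/(1 − a) + 1/(1 − b))` for `m ≤ ½(a + b)`, `a, b < 1`;
* **`symmetrised_invAcceptanceColumn_le`** — `g² ∘ σ = g²`, `G₂(q̃) < ∞` ⇒ `G₂(q̃ₛ) ≤ G₂(q̃)` (finite);
* `symmetrised_accMass_ge` — `P_ρ(q̃ₛ) ≥ P_ρ(q̃)`;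
* **`symmetrised_tauInt_le_acceptanceCeiling`** — `g` centred, `P = ∫ g² w > 0`, `g² ∘ σ = g²`,
  `G₂(q̃) < ∞`: the normalised series of `g` under `imhOp μ w q̃ₛ` is SUMMABLE and
  `τ_int^{q̃ₛ}(g) ≤ G₂(q̃) (Z/P_ρ(q̃))/P − ½` — the symmetrised arm satisfies the ORIGINAL arm's ceiling.

Lattice (`Λ = Fin (n+1)`, every `λ > 0`, real `J`, every positive model density; `σ = (φ ↦ −φ)`):
* **`phi4FlowSym_tauInt_le_acceptanceCeiling_even`** — every EVEN `f ∈ PolyObs` (`f(−φ) = f(φ)`: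
  energy, `χ₂`, `G(0,0)`, `M²`, …) with `Var f > 0` and `G₂(q̃) < ∞`: summable under the symmetrised
  arm with `τ_intₛ(f) ≤ E_{g²}[1/ρ_q̃]/ā_q̃ − ½`;
* **`phi4FlowSym_tauInt_le_acceptanceCeiling_odd`** — the same for ODD `f ∈ PolyObs`.

PRIOR ART NAMED (not cited): the construction is the 'single-model symmetrized mixture' of Boyda et
al. 2021 / Hackett et al. 2021 §4.2; the guarantees are the cell's typing; the nearest printed
ordering is Tierney 1998 Prop. 5 (tree: `Literature.Probability.MarkovChains.MixtureProposalPeskun`).  NOT CLAIMED: the Peskun-type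
order `τ_intₛ(g) ≤ τ_int(g)` itself (that is `FlowSamplerSymmetrisationDirichlet`; here only the
certified ceiling and its columns are compared); any value of `G₂`, `ā` for any network; anything for the HMC / local arms.
-/

namespace Summit.Ventures.LatticeQCDFlow.Exactness

open Real MeasureTheory Filter Finset Set Topology
open Summit.Ventures.LatticeQCDFlow.Scoring

/-- Convexity of `t ↦ 1/(1 − t)` at a midpoint, monotone form: `m ≤ (a + b)/2`, `a, b < 1` ⇒
`1/(1 − m) ≤ (1/(1 − a) + 1/(1 − b))/2`. -/
theorem one_div_one_sub_le_midpoint {a b m : ℝ} (ha : a < 1) (hb : b < 1) (hm : m ≤ (a + b) / 2) :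
    1 / (1 - m) ≤ (1 / (1 - a) + 1 / (1 - b)) / 2 := by
  have h := odds_le_midpoint ha hb hm
  have hm1 : m < 1 := by linarith
  have e : ∀ t : ℝ, t < 1 → 1 / (1 - t) = t / (1 - t) + 1 := fun t ht => by
    have h' : (1 - t) ≠ 0 := by linarith
    field_simp
    ring
  rw [e m hm1, e a ha, e b hb]
  linarith

section General

variable {X : Type*} [MeasurableSpace X] {μ : Measure X} [SFinite μ] {w q : X → ℝ} {σ : X → X}

/-- **THE INVERSE-ACCEPTANCE COLUMN NEVER INCREASES**: `σ` a measure-preserving involution,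
`w ∘ σ = w`, `q̃ > 0` normalised, `g` measurable with `g² ∘ σ = g²`; if `G₂(q̃) = ∫ g² w/ρ_q̃ < ∞` then
`G₂(q̃ₛ) = ∫ g² w/ρ_{q̃ₛ}` is finite and `≤ G₂(q̃)` (`ρ = 1 − λ∘b` the per-configuration acceptance). -/
theorem symmetrised_invAcceptanceColumn_le (hσ : MeasurePreserving σ μ μ) (hσσ : ∀ x, σ (σ x) = x)
    (hw0 : ∀ t, 0 < w t) (hwm : Measurable w) (hwi : Integrable w μ) (hw : ∀ t, w (σ t) = w t)
    (hq0 : ∀ t, 0 < q t) (hqm : Measurable q) (hqi : Integrable q μ) (hq1 : ∫ z, q z ∂μ = 1)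
    {g : X → ℝ} (hgm : Measurable g) (hg : ∀ t, g (σ t) ^ 2 = g t ^ 2)
    (hG : Integrable (fun t => g t ^ 2 * w t / (1 - rejCurve μ w q (w t / q t))) μ) :
    Integrable (fun t => g t ^ 2 * w t
        / (1 - rejCurve μ w (fun s => (q s + q (σ s)) / 2) (w t / ((q t + q (σ t)) / 2)))) μ ∧
    ∫ t, g t ^ 2 * w t
        / (1 - rejCurve μ w (fun s => (q s + q (σ s)) / 2) (w t / ((q t + q (σ t)) / 2))) ∂μ
      ≤ ∫ t, g t ^ 2 * w t / (1 - rejCurve μ w q (w t / q t)) ∂μ := by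
  obtain ⟨hs0, hsm, hsi, hs1, -⟩ := symmetrised_facts hσ hσσ hq0 hqm hqi hq1
  obtain ⟨hρsm, hρs⟩ := acc_facts hw0 hwm hwi hs0 hsm hsi hs1
  have hlt : ∀ t, rejCurve μ w q (w t / q t) < 1 := fun t =>
    rejCurve_lt_one hw0 hwm hq0 hqm hqi hq1 (div_pos (hw0 t) (hq0 t))
  -- pointwise `1/ρₛ ≤ ½(1/ρ + 1/ρ∘σ)` from `rₛ ≤ ½(r + r∘σ)` (r-forms ↔ rejCurve-forms)
  have hpt : ∀ t, 1 / (1 - rejCurve μ w (fun s => (q s + q (σ s)) / 2) (w t / ((q t + q (σ t)) / 2)))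
      ≤ (1 / (1 - rejCurve μ w q (w t / q t)) + 1 / (1 - rejCurve μ w q (w (σ t) / q (σ t)))) / 2 :=
    fun t => by
      have h := symmetrised_rejection_le hσ hσσ hw0 hwm hw hq0 hqm hqi hq1 t
      rw [rejection_eq_rejCurve hw0 hq0 t, rejection_eq_rejCurve hw0 hq0 (σ t),
        rejection_eq_rejCurve hw0 hs0 t] at h
      exact one_div_one_sub_le_midpoint (hlt t) (hlt (σ t)) h
  set A : X → ℝ := fun t => g t ^ 2 * w t / (1 - rejCurve μ w q (w t / q t)) with hA
  have hAσ : Integrable (fun t => A (σ t)) μ := integrable_comp_involution hσ hσσ hG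
  have hAσ_eq : ∀ t, A (σ t) = g t ^ 2 * w t / (1 - rejCurve μ w q (w (σ t) / q (σ t))) := fun t => by
    show g (σ t) ^ 2 * w (σ t) / (1 - rejCurve μ w q (w (σ t) / q (σ t)))
      = g t ^ 2 * w t / (1 - rejCurve μ w q (w (σ t) / q (σ t)))
    rw [hg t, hw t]
  have hσint : ∫ t, A (σ t) ∂μ = ∫ t, A t ∂μ := integral_comp_involution hσ hσσ A
  have hgw0 : ∀ t, 0 ≤ g t ^ 2 * w t := fun t => mul_nonneg (sq_nonneg _) (hw0 t).le
  have hnn : ∀ t, 0 ≤ g t ^ 2 * w t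
      / (1 - rejCurve μ w (fun s => (q s + q (σ s)) / 2) (w t / ((q t + q (σ t)) / 2))) :=
    fun t => div_nonneg (hgw0 t) (hρs t).1.le
  have hpt' : ∀ t, g t ^ 2 * w t
      / (1 - rejCurve μ w (fun s => (q s + q (σ s)) / 2) (w t / ((q t + q (σ t)) / 2)))
        ≤ (A t + A (σ t)) / 2 := fun t => by
    rw [hAσ_eq t]
    have e1 : g t ^ 2 * w t
        / (1 - rejCurve μ w (fun s => (q s + q (σ s)) / 2) (w t / ((q t + q (σ t)) / 2)))
        = g t ^ 2 * w t * (1 / (1 - rejCurve μ w (fun s => (q s + q (σ s)) / 2)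
            (w t / ((q t + q (σ t)) / 2)))) := by ring
    have e2 : (A t + g t ^ 2 * w t / (1 - rejCurve μ w q (w (σ t) / q (σ t)))) / 2
        = g t ^ 2 * w t * ((1 / (1 - rejCurve μ w q (w t / q t))
            + 1 / (1 - rejCurve μ w q (w (σ t) / q (σ t)))) / 2) := by
      simp only [hA]
      ring
    rw [e1, e2]
    exact mul_le_mul_of_nonneg_left (hpt t) (hgw0 t)
  have hint : Integrable (fun t => g t ^ 2 * w t
      / (1 - rejCurve μ w (fun s => (q s + q (σ s)) / 2) (w t / ((q t + q (σ t)) / 2)))) μ := by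
    refine Integrable.mono' ((hG.add hAσ).div_const 2)
      (((hgm.pow_const 2).mul hwm).div hρsm).aestronglyMeasurable (Eventually.of_forall fun t => ?_)
    rw [Real.norm_eq_abs, abs_of_nonneg (hnn t)]
    exact hpt' t
  refine ⟨hint, ?_⟩
  calc ∫ t, g t ^ 2 * w t
        / (1 - rejCurve μ w (fun s => (q s + q (σ s)) / 2) (w t / ((q t + q (σ t)) / 2))) ∂μ
      ≤ ∫ t, (A t + A (σ t)) / 2 ∂μ := integral_mono hint ((hG.add hAσ).div_const 2) hpt'
    _ = ∫ t, A t ∂μ := by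
        rw [integral_div, integral_add hG hAσ, hσint]
        ring

/-- **The accepted mass never drops**: `P_ρ(q̃ₛ) = ∫ ρ_{q̃ₛ} w ≥ ∫ ρ_q̃ w = P_ρ(q̃)`
(`symmetrised_meanRejection_le` in the `rejCurve` vocabulary). -/
theorem symmetrised_accMass_ge (hσ : MeasurePreserving σ μ μ) (hσσ : ∀ x, σ (σ x) = x)
    (hw0 : ∀ t, 0 < w t) (hwm : Measurable w) (hwi : Integrable w μ) (hw : ∀ t, w (σ t) = w t)
    (hq0 : ∀ t, 0 < q t) (hqm : Measurable q) (hqi : Integrable q μ) (hq1 : ∫ z, q z ∂μ = 1) :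
    ∫ t, (1 - rejCurve μ w q (w t / q t)) * w t ∂μ
      ≤ ∫ t, (1 - rejCurve μ w (fun s => (q s + q (σ s)) / 2) (w t / ((q t + q (σ t)) / 2)))
          * w t ∂μ := by
  obtain ⟨hs0, hsm, hsi, hs1, -⟩ := symmetrised_facts hσ hσσ hq0 hqm hqi hq1
  obtain ⟨hr0, hr1, hrm⟩ := rejection_bounds (μ := μ) hw0 hwm hq0 hqm hqi hq1
  obtain ⟨hs0', hs1', hsm'⟩ := rejection_bounds (μ := μ) hw0 hwm hs0 hsm hsi hs1
  have h := symmetrised_meanRejection_le hσ hσσ hw0 hwm hwi hw hq0 hqm hqi hq1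
  have hrw : Integrable (fun t => (∫ z, (1 - imhAcceptQ w q t z) * q z ∂μ) * w t) μ := by
    refine Integrable.mono' hwi (hrm.mul hwm).aestronglyMeasurable (Eventually.of_forall fun t => ?_)
    rw [Real.norm_eq_abs, abs_of_nonneg (mul_nonneg (hr0 t) (hw0 t).le)]
    exact mul_le_of_le_one_left (hw0 t).le (hr1 t)
  have hrsw : Integrable (fun t => (∫ z, (1 - imhAcceptQ w (fun s => (q s + q (σ s)) / 2) t z)
      * ((q z + q (σ z)) / 2) ∂μ) * w t) μ := by
    refine Integrable.mono' hwi (hsm'.mul hwm).aestronglyMeasurable (Eventually.of_forall fun t => ?_)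
    rw [Real.norm_eq_abs, abs_of_nonneg (mul_nonneg (hs0' t) (hw0 t).le)]
    exact mul_le_of_le_one_left (hw0 t).le (hs1' t)
  have e1 : ∫ t, (1 - rejCurve μ w q (w t / q t)) * w t ∂μ
      = (∫ t, w t ∂μ) - ∫ t, (∫ z, (1 - imhAcceptQ w q t z) * q z ∂μ) * w t ∂μ := by
    rw [← integral_sub hwi hrw]
    refine integral_congr_ae (Eventually.of_forall fun t => ?_)
    show (1 - rejCurve μ w q (w t / q t)) * w t = w t - (∫ z, (1 - imhAcceptQ w q t z) * q z ∂μ) * w t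
    rw [← rejection_eq_rejCurve hw0 hq0 t]
    ring
  have e2 : ∫ t, (1 - rejCurve μ w (fun s => (q s + q (σ s)) / 2) (w t / ((q t + q (σ t)) / 2)))
        * w t ∂μ
      = (∫ t, w t ∂μ) - ∫ t, (∫ z, (1 - imhAcceptQ w (fun s => (q s + q (σ s)) / 2) t z)
          * ((q z + q (σ z)) / 2) ∂μ) * w t ∂μ := by
    rw [← integral_sub hwi hrsw]
    refine integral_congr_ae (Eventually.of_forall fun t => ?_)
    show (1 - rejCurve μ w (fun s => (q s + q (σ s)) / 2) (w t / ((q t + q (σ t)) / 2))) * w t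
      = w t - (∫ z, (1 - imhAcceptQ w (fun s => (q s + q (σ s)) / 2) t z) * ((q z + q (σ z)) / 2) ∂μ)
        * w t
    rw [← rejection_eq_rejCurve hw0 hs0 t]
    ring
  rw [e1, e2]
  linarith

/-- **THE SYMMETRISED SAMPLER SATISFIES THE ORIGINAL SAMPLER'S CEILING.**  `g` measurable, centred
(`∫ g w = 0`), `P = ∫ g² w > 0`, `g² ∘ σ = g²` (even or odd `g`), `G₂(q̃) < ∞`.  Then under `imhOp μ w q̃ₛ`
the normalised autocorrelation series of `g` is SUMMABLE and
`τ_int^{q̃ₛ}(g) ≤ G₂(q̃) · (Z/P_ρ(q̃)) / P − ½ = E_{g²w}[1/ρ_q̃]/ā_q̃ − ½`. -/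
theorem symmetrised_tauInt_le_acceptanceCeiling (hσ : MeasurePreserving σ μ μ)
    (hσσ : ∀ x, σ (σ x) = x) (hw0 : ∀ t, 0 < w t) (hwm : Measurable w) (hwi : Integrable w μ)
    (hw : ∀ t, w (σ t) = w t) (hq0 : ∀ t, 0 < q t) (hqm : Measurable q) (hqi : Integrable q μ)
    (hq1 : ∫ z, q z ∂μ = 1) {g : X → ℝ} (hgm : Measurable g)
    (hg2 : Integrable (fun t => g t ^ 2 * w t) μ) (hg0 : ∫ t, g t * w t ∂μ = 0)
    (hP : 0 < ∫ t, g t ^ 2 * w t ∂μ) (hg : ∀ t, g (σ t) ^ 2 = g t ^ 2)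
    (hG : Integrable (fun t => g t ^ 2 * w t / (1 - rejCurve μ w q (w t / q t))) μ) :
    (Summable fun n => (∫ t, g t * ((imhOp μ w (fun s => (q s + q (σ s)) / 2))^[n + 1] g) t * w t ∂μ)
      / ∫ t, g t ^ 2 * w t ∂μ) ∧
    tauInt (fun n => (∫ t, g t * ((imhOp μ w (fun s => (q s + q (σ s)) / 2))^[n] g) t * w t ∂μ)
        / ∫ t, g t ^ 2 * w t ∂μ)
      ≤ (∫ t, g t ^ 2 * w t / (1 - rejCurve μ w q (w t / q t)) ∂μ)
          * ((∫ z, w z ∂μ) / ∫ t, (1 - rejCurve μ w q (w t / q t)) * w t ∂μ)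
          / (∫ t, g t ^ 2 * w t ∂μ) - 1 / 2 := by
  obtain ⟨hs0, hsm, hsi, hs1, -⟩ := symmetrised_facts hσ hσσ hq0 hqm hqi hq1
  obtain ⟨hGs, hGle⟩ := symmetrised_invAcceptanceColumn_le hσ hσσ hw0 hwm hwi hw hq0 hqm hqi hq1 hgm
    hg hG
  obtain ⟨hsum, hτ⟩ := imhOp_tauInt_le_acceptanceCeiling_of_sq hw0 hwm hwi hs0 hsm hsi hs1 hgm hg2 hg0
    hP hGs
  refine ⟨hsum, hτ.trans ?_⟩
  have hPρ : 0 < ∫ t, (1 - rejCurve μ w q (w t / q t)) * w t ∂μ :=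
    (acc_mul_weight_integral_pos hw0 hwm hwi hq0 hqm hqi hq1).2
  have hPρs := symmetrised_accMass_ge hσ hσσ hw0 hwm hwi hw hq0 hqm hqi hq1
  have hZ : 0 < ∫ z, w z ∂μ := integral_pos_of_pos hw0 hwi hq1
  have hG0 : 0 ≤ ∫ t, g t ^ 2 * w t
      / (1 - rejCurve μ w (fun s => (q s + q (σ s)) / 2) (w t / ((q t + q (σ t)) / 2))) ∂μ :=
    integral_nonneg fun t => div_nonneg (mul_nonneg (sq_nonneg _) (hw0 t).le)
      ((acc_facts hw0 hwm hwi hs0 hsm hsi hs1).2 t).1.le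
  have h1 : (∫ z, w z ∂μ) / ∫ t, (1 - rejCurve μ w (fun s => (q s + q (σ s)) / 2)
        (w t / ((q t + q (σ t)) / 2))) * w t ∂μ
      ≤ (∫ z, w z ∂μ) / ∫ t, (1 - rejCurve μ w q (w t / q t)) * w t ∂μ :=
    div_le_div_of_nonneg_left hZ.le hPρ hPρs
  have h2 := mul_le_mul hGle h1 (div_nonneg hZ.le (hPρ.le.trans hPρs)) (hG0.trans hGle)
  linarith [div_le_div_of_nonneg_right h2 hP.le]

end General

/-! ## The lattice: even and odd polynomial observables of φ⁴ -/

section Lattice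

variable {n : ℕ}

/-- **THE SYMMETRISED FLOW ARM SATISFIES THE FLOW ARM'S CEILING FOR EVERY EVEN POLYNOMIAL OBSERVABLE**
(energy `E`, `χ₂`, `G(0,0)`, `M²`, …): every `λ > 0`, real `J`, positive measurable model density
with `∫ q̃ = 1`; `f ∈ PolyObs` with `f(−φ) = f(φ)`, `Var f > 0`, `g = f − ⟨f⟩`, `G₂(q̃) = ∫ g² e^{−S}/ρ_q̃ < ∞`.
Then under `imhOpPhi4 J λ q̃ₛ` the normalised series of `f` is summable and
`τ_intₛ(f) ≤ G₂(q̃) (Z/P_ρ(q̃)) / ∫ g² e^{−S} − ½ = E_{g²}[1/ρ_q̃]/ā_q̃ − ½`. -/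
theorem phi4FlowSym_tauInt_le_acceptanceCeiling_even {lam : ℝ} (hlam : 0 < lam)
    (J : Fin (n + 1) → Fin (n + 1) → ℝ) {q : (Fin (n + 1) → ℝ) → ℝ} (hq0 : ∀ φ, 0 < q φ)
    (hqm : Measurable q) (hqi : Integrable q) (hq1 : ∫ φ, q φ = 1) {f : (Fin (n + 1) → ℝ) → ℝ}
    (hf : PolyObs f) (heven : ∀ φ, f (-φ) = f φ)
    (hP : 0 < ∫ φ, (f φ - gibbsExpect J lam f) ^ 2 * gibbsWeight J lam φ)
    (hG : Integrable (fun φ => (f φ - gibbsExpect J lam f) ^ 2 * gibbsWeight J lam φ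
      / (1 - rejCurve volume (gibbsWeight J lam) q (gibbsWeight J lam φ / q φ)))) :
    (Summable fun k => (∫ φ, (f φ - gibbsExpect J lam f)
        * ((imhOpPhi4 J lam (fun ψ => (q ψ + q (-ψ)) / 2))^[k + 1]
            (fun ψ => f ψ - gibbsExpect J lam f)) φ * gibbsWeight J lam φ)
        / ∫ φ, (f φ - gibbsExpect J lam f) ^ 2 * gibbsWeight J lam φ) ∧
    tauInt (fun k => (∫ φ, (f φ - gibbsExpect J lam f)
        * ((imhOpPhi4 J lam (fun ψ => (q ψ + q (-ψ)) / 2))^[k]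
            (fun ψ => f ψ - gibbsExpect J lam f)) φ * gibbsWeight J lam φ)
        / ∫ φ, (f φ - gibbsExpect J lam f) ^ 2 * gibbsWeight J lam φ)
      ≤ (∫ φ, (f φ - gibbsExpect J lam f) ^ 2 * gibbsWeight J lam φ
            / (1 - rejCurve volume (gibbsWeight J lam) q (gibbsWeight J lam φ / q φ)))
          * ((∫ φ, gibbsWeight J lam φ) / ∫ φ, (1 - rejCurve volume (gibbsWeight J lam) q
              (gibbsWeight J lam φ / q φ)) * gibbsWeight J lam φ)
          / (∫ φ, (f φ - gibbsExpect J lam f) ^ 2 * gibbsWeight J lam φ) - 1 / 2 := by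
  obtain ⟨hgm, hg2⟩ := polyObs_sq_integrable hlam J (polyObs_sub_const hf (gibbsExpect J lam f))
  have hg0 := integral_polyObs_sub_gibbsExpect hlam J hf
  haveI := isNegInvariant_volume_pi (Λ := Fin (n + 1))
  rw [imhOpPhi4_eq_imhOp]
  exact symmetrised_tauInt_le_acceptanceCeiling (μ := volume) (σ := fun ψ : Fin (n + 1) → ℝ => -ψ)
    (Measure.measurePreserving_neg volume) (fun φ => neg_neg φ) (fun φ => gibbsWeight_pos J lam φ)
    (continuous_gibbsWeight J lam).measurable (integrable_gibbsWeight hlam J)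
    (fun φ => gibbsWeight_neg J lam φ) hq0 hqm hqi hq1 hgm hg2 hg0 hP
    (fun φ => by rw [heven φ]) hG

/-- **… AND FOR EVERY ODD POLYNOMIAL OBSERVABLE** (`f(−φ) = −f(φ)`, then `⟨f⟩ = 0`; the magnetisation,
`Σφ³`, a staggered magnetisation): same hypotheses and conclusion. -/
theorem phi4FlowSym_tauInt_le_acceptanceCeiling_odd {lam : ℝ} (hlam : 0 < lam)
    (J : Fin (n + 1) → Fin (n + 1) → ℝ) {q : (Fin (n + 1) → ℝ) → ℝ} (hq0 : ∀ φ, 0 < q φ)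
    (hqm : Measurable q) (hqi : Integrable q) (hq1 : ∫ φ, q φ = 1) {f : (Fin (n + 1) → ℝ) → ℝ}
    (hf : PolyObs f) (hodd : ∀ φ, f (-φ) = -f φ)
    (hP : 0 < ∫ φ, (f φ - gibbsExpect J lam f) ^ 2 * gibbsWeight J lam φ)
    (hG : Integrable (fun φ => (f φ - gibbsExpect J lam f) ^ 2 * gibbsWeight J lam φ
      / (1 - rejCurve volume (gibbsWeight J lam) q (gibbsWeight J lam φ / q φ)))) :
    (Summable fun k => (∫ φ, (f φ - gibbsExpect J lam f)
        * ((imhOpPhi4 J lam (fun ψ => (q ψ + q (-ψ)) / 2))^[k + 1]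
            (fun ψ => f ψ - gibbsExpect J lam f)) φ * gibbsWeight J lam φ)
        / ∫ φ, (f φ - gibbsExpect J lam f) ^ 2 * gibbsWeight J lam φ) ∧
    tauInt (fun k => (∫ φ, (f φ - gibbsExpect J lam f)
        * ((imhOpPhi4 J lam (fun ψ => (q ψ + q (-ψ)) / 2))^[k]
            (fun ψ => f ψ - gibbsExpect J lam f)) φ * gibbsWeight J lam φ)
        / ∫ φ, (f φ - gibbsExpect J lam f) ^ 2 * gibbsWeight J lam φ)
      ≤ (∫ φ, (f φ - gibbsExpect J lam f) ^ 2 * gibbsWeight J lam φ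
            / (1 - rejCurve volume (gibbsWeight J lam) q (gibbsWeight J lam φ / q φ)))
          * ((∫ φ, gibbsWeight J lam φ) / ∫ φ, (1 - rejCurve volume (gibbsWeight J lam) q
              (gibbsWeight J lam φ / q φ)) * gibbsWeight J lam φ)
          / (∫ φ, (f φ - gibbsExpect J lam f) ^ 2 * gibbsWeight J lam φ) - 1 / 2 := by
  obtain ⟨hgm, hg2⟩ := polyObs_sq_integrable hlam J (polyObs_sub_const hf (gibbsExpect J lam f))
  have hg0 := integral_polyObs_sub_gibbsExpect hlam J hf
  haveI := isNegInvariant_volume_pi (Λ := Fin (n + 1))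
  -- `⟨f⟩ = 0` for odd `f`, so `g(−φ) = −g(φ)`
  have hE : gibbsExpect J lam f = 0 := by
    have h := integral_neg_eq_self (fun φ : Fin (n + 1) → ℝ => f φ * gibbsWeight J lam φ) volume
    have e : (fun φ : Fin (n + 1) → ℝ => f (-φ) * gibbsWeight J lam (-φ))
        = fun φ => -(f φ * gibbsWeight J lam φ) := by
      funext φ
      rw [hodd, gibbsWeight_neg]
      ring
    rw [e, integral_neg] at h
    unfold gibbsExpect
    rw [show (∫ φ : Fin (n + 1) → ℝ, f φ * gibbsWeight J lam φ) = 0 by linarith, zero_div]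
  rw [imhOpPhi4_eq_imhOp]
  exact symmetrised_tauInt_le_acceptanceCeiling (μ := volume) (σ := fun ψ : Fin (n + 1) → ℝ => -ψ)
    (Measure.measurePreserving_neg volume) (fun φ => neg_neg φ) (fun φ => gibbsWeight_pos J lam φ)
    (continuous_gibbsWeight J lam).measurable (integrable_gibbsWeight hlam J)
    (fun φ => gibbsWeight_neg J lam φ) hq0 hqm hqi hq1 hgm hg2 hg0 hP
    (fun φ => by rw [hodd φ, hE, sub_zero, sub_zero, neg_sq]) hG

end Lattice

end Summit.Ventures.LatticeQCDFlow.Exactness
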